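import Summits.CriticalPhenomena.CardyFormulaZ2.Theorems.CardyBoundaryCoulombGasRectilinearCardyStubBoundaryFeetPart2
import Summits.CriticalPhenomena.CardyFormulaZ2.Theorems.CardyBoundaryCoulombGasBoundaryDefectGaussianRStubTransportPathsPart13
import Summits.CriticalPhenomena.CardyFormulaZ2.Theorems.CardyBoundaryCoulombGasBoundaryDefectGaussianRStubTransportPathsPart16
import Summits.CriticalPhenomena.CardyFormulaZ2.Theorems.CardyBoundaryCoulombGasRectilinearCardyLocalSide
import HarnessLib

/-!
# Stub `stub_boundaryFeet` of line `excursion-kernel-covariance` — Part 3: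
# inside one oriented wedge: signed positions, ray parameters, the lattice chart
# (crux `RectilinearCardy`, stmt-CriticalPhenomena-5660)

For an oriented wedge at `t₀` (apex `p = γ t₀`, radius `r`, window `η`, frame `a`, type `m`):

* `bftSpos` — the SIGNED POSITION `± ‖γ u - p‖` of a window parameter `u` (sign of `u - t₀`); it
  is strictly increasing on the window (`bft_spos_strictMono`) and dominates distances
  (`bft_spos_dist`);
* `bft_ray_fwd` / `bft_ray_bwd` — points of the outgoing ray `p + x i^a` / incoming ray
  `p + x i^(a+m)` with `0 ≤ x < r` are `γ u` for a window parameter `u` with signed position `± x`;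
* `bft_window_inj` — `γ` is injective on the window;
* `bft_lattice_mem`, `bft_frame_chart` — the closure lattice polygon read in the frame
  of the wedge: half-plane / quadrant / co-quadrant thresholds `X`, `Y`, and the same on the
  frame box of radius `2` about a vertex.
All [folklore].
-/

noncomputable section

open Set Filter Metric Topology
open Literature.Probability.RandomPlanarGeometry
open Literature.Probability.LatticeModels Literature.Probability.LatticeModels.CollarLegModel
open Summit.CriticalPhenomena.CardyFormulaZ2.Cruxes.BoundaryDefectGaussianR.RainbowMonomialsInExcursionKernels

namespace Summit.CriticalPhenomena.CardyFormulaZ2.Cruxes.RectilinearCardy.ExcursionKernelCovariance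

/-! ### Signed positions in a wedge window -/

/-- The signed position of the window parameter `u` relative to the apex parameter `t₀`:
`‖γ u - γ t₀‖` after the apex, `-‖γ u - γ t₀‖` before it. [folklore] -/
def bftSpos (D : JordanDomain) (t₀ u : ℝ) : ℝ :=
  if t₀ ≤ u then ‖D.boundary u - D.boundary t₀‖ else -‖D.boundary u - D.boundary t₀‖

/-- **The signed position is strictly increasing on the window.** [folklore] -/
theorem bft_spos_strictMono (D : JordanDomain) {t₀ η : ℝ}
    (hmonoA : StrictMonoOn (fun t => ‖D.boundary t - D.boundary t₀‖) (Icc t₀ (t₀ + η)))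
    (hantiB : StrictAntiOn (fun t => ‖D.boundary t - D.boundary t₀‖) (Icc (t₀ - η) t₀)) :
    StrictMonoOn (bftSpos D t₀) (Icc (t₀ - η) (t₀ + η)) := by
  intro u hu u' hu' hlt
  simp only [bftSpos]
  by_cases h1 : t₀ ≤ u
  · have h2 : t₀ ≤ u' := h1.trans hlt.le
    rw [if_pos h1, if_pos h2]
    exact hmonoA ⟨h1, hu.2⟩ ⟨h2, hu'.2⟩ hlt
  · rw [if_neg h1]
    rw [not_le] at h1
    have hpos : 0 < ‖D.boundary u - D.boundary t₀‖ := by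
      have := hantiB ⟨hu.1, h1.le⟩ ⟨by linarith [hu.1], le_rfl⟩ h1
      simpa using this
    by_cases h2 : t₀ ≤ u'
    · rw [if_pos h2]
      linarith [norm_nonneg (D.boundary u' - D.boundary t₀)]
    · rw [if_neg h2]
      rw [not_le] at h2
      have := hantiB ⟨hu.1, h1.le⟩ ⟨hu'.1, h2.le⟩ hlt
      simp only at this
      linarith

/-- **Distances are dominated by signed positions** on the window. [folklore] -/
theorem bft_spos_dist (D : JordanDomain) {t₀ η : ℝ} {a m : ℕ}
    (hdirA : ∀ t ∈ Icc t₀ (t₀ + η), D.boundary t =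
      D.boundary t₀ + ((‖D.boundary t - D.boundary t₀‖ : ℝ) : ℂ) * Complex.I ^ a)
    (hdirB : ∀ t ∈ Icc (t₀ - η) t₀, D.boundary t =
      D.boundary t₀ + ((‖D.boundary t - D.boundary t₀‖ : ℝ) : ℂ) * Complex.I ^ (a + m))
    {u u' : ℝ} (hu : u ∈ Icc (t₀ - η) (t₀ + η)) (hu' : u' ∈ Icc (t₀ - η) (t₀ + η)) :
    dist (D.boundary u) (D.boundary u') ≤ |bftSpos D t₀ u - bftSpos D t₀ u'| := by
  have key : ∀ (e : ℕ) (x y : ℝ), dist (D.boundary t₀ + ((x : ℝ) : ℂ) * Complex.I ^ e)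
      (D.boundary t₀ + ((y : ℝ) : ℂ) * Complex.I ^ e) = |x - y| := by
    intro e x y
    rw [dist_eq_norm, show D.boundary t₀ + ((x : ℝ) : ℂ) * Complex.I ^ e -
      (D.boundary t₀ + ((y : ℝ) : ℂ) * Complex.I ^ e) = ((x - y : ℝ) : ℂ) * Complex.I ^ e by
      push_cast; ring, norm_mul, norm_pow, Complex.norm_I, one_pow, mul_one, Complex.norm_real,
      Real.norm_eq_abs]
  have htri : dist (D.boundary u) (D.boundary u') ≤
      ‖D.boundary u - D.boundary t₀‖ + ‖D.boundary u' - D.boundary t₀‖ := by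
    have := dist_triangle (D.boundary u) (D.boundary t₀) (D.boundary u')
    rwa [dist_eq_norm (D.boundary u) (D.boundary t₀), dist_eq_norm (D.boundary t₀),
      norm_sub_rev (D.boundary t₀)] at this
  simp only [bftSpos]
  by_cases h1 : t₀ ≤ u <;> by_cases h2 : t₀ ≤ u'
  · rw [if_pos h1, if_pos h2]
    have e := key a ‖D.boundary u - D.boundary t₀‖ ‖D.boundary u' - D.boundary t₀‖
    rw [← hdirA u ⟨h1, hu.2⟩, ← hdirA u' ⟨h2, hu'.2⟩] at e
    rw [e]
  · rw [if_pos h1, if_neg h2, sub_neg_eq_add, abs_of_nonneg (by positivity)]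
    exact htri
  · rw [if_neg h1, if_pos h2, show -‖D.boundary u - D.boundary t₀‖ - ‖D.boundary u' - D.boundary t₀‖
      = -(‖D.boundary u - D.boundary t₀‖ + ‖D.boundary u' - D.boundary t₀‖) by ring, abs_neg,
      abs_of_nonneg (by positivity)]
    exact htri
  · rw [not_le] at h1 h2
    rw [if_neg (not_le.2 h1), if_neg (not_le.2 h2), show -‖D.boundary u - D.boundary t₀‖ -
      -‖D.boundary u' - D.boundary t₀‖ = -(‖D.boundary u - D.boundary t₀‖ -
        ‖D.boundary u' - D.boundary t₀‖) by ring, abs_neg]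
    have e := key (a + m) ‖D.boundary u - D.boundary t₀‖ ‖D.boundary u' - D.boundary t₀‖
    rw [← hdirB u ⟨hu.1, h1.le⟩, ← hdirB u' ⟨hu'.1, h2.le⟩] at e
    rw [e]

/-- **Points of the outgoing ray are window points after the apex.** [folklore] -/
theorem bft_ray_fwd (D : JordanDomain) {t₀ r η : ℝ} {a : ℕ} (hη : 0 < η)
    (hdirA : ∀ t ∈ Icc t₀ (t₀ + η), D.boundary t =
      D.boundary t₀ + ((‖D.boundary t - D.boundary t₀‖ : ℝ) : ℂ) * Complex.I ^ a)
    (hrA : r < ‖D.boundary (t₀ + η) - D.boundary t₀‖) {x : ℝ} (hx0 : 0 ≤ x) (hxr : x < r) :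
    ∃ u, u ∈ Ico t₀ (t₀ + η) ∧ D.boundary u = D.boundary t₀ + (x : ℂ) * Complex.I ^ a ∧
      bftSpos D t₀ u = x := by
  obtain ⟨u, hu, hue⟩ := exists_mem_Icc_eq_of_norm_le' D.continuous_boundary (by linarith) hdirA
    rfl hx0 (by linarith : x ≤ ‖D.boundary (t₀ + η) - D.boundary t₀‖)
  have hnorm : ‖D.boundary u - D.boundary t₀‖ = x := by
    rw [hue, add_sub_cancel_left, norm_mul, norm_pow, Complex.norm_I, one_pow, mul_one,
      Complex.norm_real, Real.norm_eq_abs, abs_of_nonneg hx0]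
  have hne : u ≠ t₀ + η := by
    rintro rfl
    linarith
  refine ⟨u, ⟨hu.1, lt_of_le_of_ne hu.2 hne⟩, hue, ?_⟩
  rw [bftSpos, if_pos hu.1, hnorm]

/-- **Points of the incoming ray are window points before the apex.** [folklore] -/
theorem bft_ray_bwd (D : JordanDomain) {t₀ r η : ℝ} {a m : ℕ} (hη : 0 < η)
    (hdirB : ∀ t ∈ Icc (t₀ - η) t₀, D.boundary t =
      D.boundary t₀ + ((‖D.boundary t - D.boundary t₀‖ : ℝ) : ℂ) * Complex.I ^ (a + m))
    (hrB : r < ‖D.boundary (t₀ - η) - D.boundary t₀‖) {x : ℝ} (hx0 : 0 ≤ x) (hxr : x < r) :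
    ∃ u, u ∈ Ioc (t₀ - η) t₀ ∧ D.boundary u = D.boundary t₀ + (x : ℂ) * Complex.I ^ (a + m) ∧
      bftSpos D t₀ u = -x := by
  obtain ⟨u, hu, hue⟩ := exists_mem_Icc_eq_of_norm_le D.continuous_boundary (by linarith) hdirB
    rfl hx0 (by linarith : x ≤ ‖D.boundary (t₀ - η) - D.boundary t₀‖)
  have hnorm : ‖D.boundary u - D.boundary t₀‖ = x := by
    rw [hue, add_sub_cancel_left, norm_mul, norm_pow, Complex.norm_I, one_pow, mul_one,
      Complex.norm_real, Real.norm_eq_abs, abs_of_nonneg hx0]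
  have hne : u ≠ t₀ - η := by
    rintro rfl
    linarith
  refine ⟨u, ⟨lt_of_le_of_ne hu.1 (Ne.symm hne), hu.2⟩, hue, ?_⟩
  rcases hu.2.lt_or_eq with h | h
  · rw [bftSpos, if_neg (not_le.2 h), hnorm]
  · subst h
    rw [sub_self, norm_zero] at hnorm
    rw [bftSpos, if_pos le_rfl, sub_self, norm_zero, ← hnorm, neg_zero]

/-- **`γ` is injective on a wedge window** (`2 η ≤ 1/2 < 1`). [folklore] -/
theorem bft_window_inj (D : JordanDomain) {t₀ η : ℝ} (hη4 : η ≤ 1 / 4) {u u' : ℝ}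
    (hu : u ∈ Icc (t₀ - η) (t₀ + η)) (hu' : u' ∈ Icc (t₀ - η) (t₀ + η))
    (h : D.boundary u = D.boundary u') : u = u' :=
  tp_injOn_Ico D (t₀ - η) ⟨hu.1, by linarith [hu.2]⟩ ⟨hu'.1, by linarith [hu'.2]⟩ h

/-! ### The closure lattice polygon in the frame of a wedge -/

/-- Unpacking the lattice sector predicate (membership of type `m` with thresholds `X` along
`dir K` and `Y` along `dir (K+1)`: quadrant, half-plane, co-quadrant), `m = 1`. [folklore] -/
theorem bft_mem_one {X Y al pe : ℤ} :
    ((1 = 1 → X ≤ al ∧ Y ≤ pe) ∧ (1 = 2 → Y ≤ pe) ∧ (1 = 3 → Y ≤ pe ∨ al ≤ X)) ↔ X ≤ al ∧ Y ≤ pe :=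
  tp_csec_one

/-- Unpacking the lattice sector predicate, `m = 2`. [folklore] -/
theorem bft_mem_two {X Y al pe : ℤ} :
    ((2 = 1 → X ≤ al ∧ Y ≤ pe) ∧ (2 = 2 → Y ≤ pe) ∧ (2 = 3 → Y ≤ pe ∨ al ≤ X)) ↔ Y ≤ pe :=
  tp_csec_two

/-- Unpacking the lattice sector predicate, `m = 3`. [folklore] -/
theorem bft_mem_three {X Y al pe : ℤ} :
    ((3 = 1 → X ≤ al ∧ Y ≤ pe) ∧ (3 = 2 → Y ≤ pe) ∧ (3 = 3 → Y ≤ pe ∨ al ≤ X)) ↔ Y ≤ pe ∨ al ≤ X :=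
  tp_csec_three

/-- The along-threshold of the lattice sector: `⌈re / δ⌉` for a quadrant or half-plane,
`⌊re / δ⌋` for a co-quadrant. [folklore] -/
def bftX (m : ℕ) (δ Pre : ℝ) : ℤ := if m = 3 then ⌊Pre / δ⌋ else ⌈Pre / δ⌉

/-- **The closure lattice polygon inside a wedge.** If within `r` of `p` the closure of `D` is
the closed sector of type `m` in the frame `K`, then for mesh points within `r` of `p`
membership in `V = {v : δ v ∈ closure D}` is the sector predicate of `⟨v, dir K⟩, ⟨v, dir (K+1)⟩` with
`X = bftX m δ (re (p (-i)^K))`, `Y = ⌈im (p (-i)^K) / δ⌉`. [folklore] -/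
theorem bft_lattice_mem (D : JordanDomain) {δ : ℝ} (hδ : 0 < δ) {V : Finset (ℤ × ℤ)}
    (hV : ∀ v : ℤ × ℤ, v ∈ V ↔ bftMesh δ v ∈ closure D.carrier) (K : Fin 4) {p : ℂ} {r : ℝ}
    {m : ℕ} (hm : m = 1 ∨ m = 2 ∨ m = 3)
    (hclos : ∀ z, dist z p < r → (z ∈ closure D.carrier ↔
      (m = 1 → 0 ≤ ((z - p) * (-Complex.I) ^ (K : ℕ)).re ∧ 0 ≤ ((z - p) * (-Complex.I) ^ (K : ℕ)).im) ∧
        (m = 2 → 0 ≤ ((z - p) * (-Complex.I) ^ (K : ℕ)).im) ∧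
        (m = 3 → 0 ≤ ((z - p) * (-Complex.I) ^ (K : ℕ)).im ∨
          ((z - p) * (-Complex.I) ^ (K : ℕ)).re ≤ 0)))
    (v : ℤ × ℤ) (hv : dist (bftMesh δ v) p < r) :
    v ∈ V ↔
      ((m = 1 → bftX m δ (p * (-Complex.I) ^ (K : ℕ)).re ≤ v.1 * (dir K).1 + v.2 * (dir K).2 ∧
          ⌈(p * (-Complex.I) ^ (K : ℕ)).im / δ⌉ ≤ v.1 * (dir (K + 1)).1 + v.2 * (dir (K + 1)).2) ∧
        (m = 2 → ⌈(p * (-Complex.I) ^ (K : ℕ)).im / δ⌉ ≤ v.1 * (dir (K + 1)).1 + v.2 * (dir (K + 1)).2) ∧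
        (m = 3 → ⌈(p * (-Complex.I) ^ (K : ℕ)).im / δ⌉ ≤ v.1 * (dir (K + 1)).1 + v.2 * (dir (K + 1)).2 ∨
          v.1 * (dir K).1 + v.2 * (dir K).2 ≤ bftX m δ (p * (-Complex.I) ^ (K : ℕ)).re)) := by
  have hV' : ∀ v : ℤ × ℤ, v ∈ V ↔
      ((v.1 : ℂ) * ((δ : ℝ) : ℂ) + (v.2 : ℂ) * ((δ : ℝ) : ℂ) * Complex.I) ∈ closure D.carrier := hV
  have hv' : dist ((v.1 : ℂ) * ((δ : ℝ) : ℂ) + (v.2 : ℂ) * ((δ : ℝ) : ℂ) * Complex.I) p < r := hv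
  rcases hm with rfl | rfl | rfl
  · have hch : ∀ w, dist w p < r → (w ∈ closure D.carrier ↔
        0 ≤ ((w - p) * (-Complex.I) ^ (K : ℕ)).re ∧ 0 ≤ ((w - p) * (-Complex.I) ^ (K : ℕ)).im) :=
      fun w hw => by rw [hclos w hw, tp_csec_one]
    rw [tp_lattice_convex hδ hV' K hch v hv', bft_mem_one, bftX, if_neg (by norm_num)]
  · have hch : ∀ w, dist w p < r → (w ∈ closure D.carrier ↔
        0 ≤ ((w - p) * (-Complex.I) ^ (K : ℕ)).im) :=
      fun w hw => by rw [hclos w hw, tp_csec_two]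
    rw [tp_lattice_flat hδ hV' K hch v hv', bft_mem_two]
  · have hch : ∀ w, dist w p < r → (w ∈ closure D.carrier ↔
        0 ≤ ((w - p) * (-Complex.I) ^ (K : ℕ)).im ∨ ((w - p) * (-Complex.I) ^ (K : ℕ)).re ≤ 0) :=
      fun w hw => by rw [hclos w hw, tp_csec_three]
    rw [tp_lattice_reflex hδ hV' K hch v hv', bft_mem_three, bftX, if_pos rfl]

/-- Frame displacements of size `≤ 2` move mesh points by less than `3 δ`. [folklore] -/
theorem bft_mesh_frame_dist {δ : ℝ} (hδ : 0 ≤ δ) (K : Fin 4) (v : ℤ × ℤ) {s t : ℤ}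
    (hs1 : -2 ≤ s) (hs2 : s ≤ 2) (ht1 : -2 ≤ t) (ht2 : t ≤ 2) :
    dist (bftMesh δ (v + s • dir K + t • dir (K + 1))) (bftMesh δ v) ≤ δ * 3 := by
  have h3 := (tp_dot_lin K v s t).2.2
  refine tp_mesh_dist_le hδ (by norm_num) (v + s • dir K + t • dir (K + 1)) v ?_
  rw [h3]
  have hs := sq_le_sq' hs1 hs2
  have ht := sq_le_sq' ht1 ht2
  push_cast
  have hs' : (s : ℝ) ^ 2 ≤ 2 ^ 2 := by exact_mod_cast hs
  have ht' : (t : ℝ) ^ 2 ≤ 2 ^ 2 := by exact_mod_cast ht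
  linarith

/-- **The frame chart about a vertex.** If the `3 δ`-disc about the mesh point of `v` lies in the
chart disc, then on the frame box of radius `2` about `v` membership in `V` is the sector
predicate of the shifted frame coordinates. [folklore] -/
theorem bft_frame_chart (D : JordanDomain) {δ : ℝ} (hδ : 0 < δ) {V : Finset (ℤ × ℤ)}
    (hV : ∀ v : ℤ × ℤ, v ∈ V ↔ bftMesh δ v ∈ closure D.carrier) (K : Fin 4) {p : ℂ} {r : ℝ}
    {m : ℕ} (hm : m = 1 ∨ m = 2 ∨ m = 3)
    (hclos : ∀ z, dist z p < r → (z ∈ closure D.carrier ↔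
      (m = 1 → 0 ≤ ((z - p) * (-Complex.I) ^ (K : ℕ)).re ∧ 0 ≤ ((z - p) * (-Complex.I) ^ (K : ℕ)).im) ∧
        (m = 2 → 0 ≤ ((z - p) * (-Complex.I) ^ (K : ℕ)).im) ∧
        (m = 3 → 0 ≤ ((z - p) * (-Complex.I) ^ (K : ℕ)).im ∨
          ((z - p) * (-Complex.I) ^ (K : ℕ)).re ≤ 0)))
    (v : ℤ × ℤ) (hv : ∀ z, dist z (bftMesh δ v) ≤ 3 * δ → dist z p < r) :
    ∀ s t : ℤ, -2 ≤ s → s ≤ 2 → -2 ≤ t → t ≤ 2 →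
      (v + s • dir K + t • dir (K + 1) ∈ V ↔
        ((m = 1 → bftX m δ (p * (-Complex.I) ^ (K : ℕ)).re ≤ v.1 * (dir K).1 + v.2 * (dir K).2 + s ∧
            ⌈(p * (-Complex.I) ^ (K : ℕ)).im / δ⌉ ≤ v.1 * (dir (K + 1)).1 + v.2 * (dir (K + 1)).2 + t) ∧
          (m = 2 → ⌈(p * (-Complex.I) ^ (K : ℕ)).im / δ⌉ ≤ v.1 * (dir (K + 1)).1 + v.2 * (dir (K + 1)).2 + t) ∧
          (m = 3 → ⌈(p * (-Complex.I) ^ (K : ℕ)).im / δ⌉ ≤ v.1 * (dir (K + 1)).1 + v.2 * (dir (K + 1)).2 + t ∨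
            v.1 * (dir K).1 + v.2 * (dir K).2 + s ≤ bftX m δ (p * (-Complex.I) ^ (K : ℕ)).re))) := by
  intro s t hs1 hs2 ht1 ht2
  have hd := bft_mesh_frame_dist hδ.le K v hs1 hs2 ht1 ht2
  have hw : dist (bftMesh δ (v + s • dir K + t • dir (K + 1))) p < r := hv _ (by linarith)
  rw [bft_lattice_mem D hδ hV K hm hclos _ hw, (tp_dot_lin K v s t).1, (tp_dot_lin K v s t).2.1]

end Summit.CriticalPhenomena.CardyFormulaZ2.Cruxes.RectilinearCardy.ExcursionKernelCovariance

end
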